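import Mathlib
import Summits.Ventures.FusionMHD.Models.RwmFRS1Kq07M3Solution
import Summits.Ventures.FusionMHD.Models.RwmFRS1Energy
import HarnessLib

/-!
# F3.r4 instance «RwmFRS1Kq07», companion mode `(3,1)`: the POSITIVE side on MODEL M_RWM,K — `δW_∞ > 0`, every admissible
# displacement has positive `(3,1)` energy with or without a wall, and the thin-wall relation has only DECAYING roots (no RWM)

The `m = 3` companion of `RwmFRS1Kq07Energy.lean` (model-6 g7; pattern of the `(4,1)` companion `RwmFRS1M4Energy.lean` of ★ #71).
MODEL M_RWM,K as there (row #95's EXACT force-balanced screw pinch `KinkEqQ07.hlK`, `q = (7/10)(1+r²)`, `q_a = 7/5`, + vacuum +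
thin resistive wall, `R₀ = 5a` DECLARED); CLASS C = the external helical mode `(m,n) = (3,1)` (`nq_a = 7/5 < m − 1`).  With the
kernel marginal solution `Kq07M3.xi` (`3.2921929 < L₃ < 3.292193`, `RwmFRS1Kq07M3Solution.lean`), the boundary form
`δŴ₃(L, Λ) = (32L − 88)/5537 + 64Λ/3675` (`RwmFRS1Kq07M3.lean`) and lit-3's GENERIC `15/16 = m/(m+ζ_a) ≤ Λ_∞ < Λ_b`
(ScrewPinchWallFactor §3, §8) — NO Bessel value needed anywhere:
* `externalEnergy_xi` — (11.148) for `ξ₁`: `externalEnergy 3 k 1 Λ ξ₁ = δŴ₃(L₃, Λ)·ξ₁(1)²`;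
* `lambdaCrit_bounds` — `−0.17994 < Λ_crit,3 < −0.17993` (NEGATIVE: `L₃ > 11/4`);
* **`dWinf_pos`** (`δW_∞ > 0`), **`dWb_pos`** (`δW_b > 0` for EVERY wall `b > a`);
* **`noWall_stable`**, **`idealWall_stable`** — via lit-4's `newcombExternalModes_iff`: EVERY admissible displacement
  (class `RwmFRS1.IsAdmissible`) has positive external `(3,1)` energy in M_RWM,K, without a wall and with a perfectly conducting
  wall at any `b > a`;
* **`no_rwm`** — for every wall `b > a`, every root of the printed thin-wall relation `γτ_w·δW_b = −δW_∞` with `τ_w > 0` has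
  `γ < 0` [Freidberg2014 §11.5.6 (11.169), p. 492 «both `δW_∞` and `δW_b` must be positive for stability» — they are].
HONESTY (the external spectrum of ONE exact equilibrium, juxtaposed, never merged): `(1,1)` internal kink CERTIFIED UNSTABLE
(★ #95); `(2,1)` external = resistive wall mode (#109-cand, `RwmFRS1Kq07Energy`); `(3,1)` external = no-wall STABLE side (this
file).  VALIDATED (not load-bearing): float `L₃ = 3.292193`, `Λ_crit,3 = −0.17993` (work/preview).  Never a device. [instance data]
-/

noncomputable section

open Set Filter Literature.Analysis.ODE Literature.MathematicalPhysics.MHD Literature.MathematicalPhysics.MHD.ScrewPinch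
open scoped Topology

namespace Summit.Ventures.FusionMHD.Models

namespace RwmFRS1

namespace Kq07M3

open Kq07

/-- **(11.148) FOR THE `(3,1)` MARGINAL SOLUTION of MODEL M_RWM,K**: `externalEnergy 3 k 1 Λ ξ₁ = δŴ₃(L₃, Λ)·ξ₁(1)²`.
[cite: Freidberg2014, §11.5.6 eq. (11.148)] -/
theorem externalEnergy_xi (Λ : ℝ) :
    PK.externalEnergy 3 kk 1 Λ Kq07M3.xi =
      Kq07M3.boundaryForm (1 * deriv Kq07M3.xi 1 / Kq07M3.xi 1) Λ * Kq07M3.xi 1 ^ 2 := by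
  obtain ⟨hBθ, hBz, hp, hBθ0⟩ := Kq07.profile_regular (51 / 50)
  have hF : ∀ r ∈ Ioc (0 : ℝ) 1, PK.kDotB 3 kk r ≠ 0 := fun r hr => Kq07M3.kDotB_ne_zero hr.1 (by nlinarith [hr.1, hr.2])
  have hODE : ∀ r ∈ Ioo (0 : ℝ) 1,
      HasDerivAt (fun s => PK.newcombF 3 kk s * deriv Kq07M3.xi s) (PK.newcombG 3 kk r * Kq07M3.xi r) r :=
    fun r hr => Kq07M3.xi_newcomb ⟨hr.1, by linarith [hr.2]⟩
  have hE := Profile.fluidEnergy_eq_boundary_of_solution (P := PK) (m := 3) (k := kk) one_pos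
    (by norm_num : (1 : ℝ) < 51 / 50) (by norm_num) hBθ hBz hp hBθ0 hF Kq07M3.xi_contDiffOn hODE
  have hx : Kq07M3.xi 1 ≠ 0 := Kq07M3.xi_ne_zero 1 ⟨one_pos, le_rfl⟩
  unfold Profile.externalEnergy
  rw [hE, Kq07M3.boundaryForm]
  unfold Profile.newcombF
  field_simp
  ring

/-- The NO-WALL reference energy of the `(3,1)` marginal solution of MODEL M_RWM,K. [cite: Freidberg2014, §11.5.6 eq. (11.149)] -/
def dWinf : ℝ := PK.externalEnergy 3 kk 1 (Vacuum.wallFactorInf 3 kk 1) Kq07M3.xi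

/-- The IDEAL-WALL reference energy of the `(3,1)` marginal solution of MODEL M_RWM,K, wall at `r = b`.
[cite: Freidberg2014, §11.5.6 eq. (11.149)] -/
def dWb (b : ℝ) : ℝ := PK.externalEnergy 3 kk 1 (Vacuum.wallFactor 3 kk 1 b) Kq07M3.xi

/-- `ξ₁(1)² > 0`. [instance data] -/
theorem xi_one_sq_pos : 0 < Kq07M3.xi 1 ^ 2 := by
  have := Kq07M3.xi_pos one_pos le_rfl
  positivity

/-- **`Λ_crit,3 ∈ (−0.17994, −0.17993)`: NEGATIVE** (`L₃ > 11/4`). [instance data] -/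
theorem lambdaCrit_bounds : (-(17994 / 100000) : ℝ) < Kq07M3.lambdaCrit (1 * deriv Kq07M3.xi 1 / Kq07M3.xi 1) ∧
    Kq07M3.lambdaCrit (1 * deriv Kq07M3.xi 1 / Kq07M3.xi 1) < (-(17993 / 100000) : ℝ) := by
  obtain ⟨h1, h2⟩ := Kq07M3.L_bounds
  unfold Kq07M3.lambdaCrit
  constructor <;> linarith

/-- `Λ_∞(3, k, 1) ≥ m/(m + |k|a) = 15/16` (lit-3 §8, generic). [cite: Freidberg2014, §11.5.6 eq. (11.150)] -/
theorem wallFactorInf_ge : (15 / 16 : ℝ) ≤ Vacuum.wallFactorInf 3 kk 1 := by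
  have h := Vacuum.div_le_wallFactorInf (m := 3) (by norm_num) (k := kk) (a := 1) (by rw [kk]; norm_num) one_pos
  rw [kk] at h ⊢
  norm_num at h ⊢
  exact h

/-- **`δW_∞ > 0`** for the `(3,1)` mode of MODEL M_RWM,K (`Λ_crit,3 < 0 < 15/16 ≤ Λ_∞`). [cite: Freidberg2014, §11.5.6 eq. (11.151)] -/
theorem dWinf_pos : 0 < Kq07M3.dWinf := by
  rw [Kq07M3.dWinf, externalEnergy_xi]
  have hpos : 0 < Kq07M3.boundaryForm (1 * deriv Kq07M3.xi 1 / Kq07M3.xi 1) (Vacuum.wallFactorInf 3 kk 1) := by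
    rw [Kq07M3.boundaryForm_pos_iff]
    linarith [lambdaCrit_bounds.2, wallFactorInf_ge]
  exact mul_pos hpos xi_one_sq_pos

/-- **`δW_b > 0` for EVERY wall `b > a`** (`Λ_b > Λ_∞`, lit-3 §3). [cite: Freidberg2014, §11.5.6 eq. (11.150)] -/
theorem dWb_pos {b : ℝ} (hb : 1 < b) : 0 < Kq07M3.dWb b := by
  rw [Kq07M3.dWb, externalEnergy_xi]
  have hk : kk ≠ 0 := by rw [kk]; norm_num
  have hlt := Vacuum.wallFactorInf_lt_wallFactor (m := 3) (by norm_num) hk one_pos hb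
  have hpos : 0 < Kq07M3.boundaryForm (1 * deriv Kq07M3.xi 1 / Kq07M3.xi 1) (Vacuum.wallFactor 3 kk 1 b) := by
    rw [Kq07M3.boundaryForm_pos_iff]
    linarith [lambdaCrit_bounds.2, wallFactorInf_ge]
  exact mul_pos hpos xi_one_sq_pos

/-- **NEWCOMB'S EXTERNAL-MODE TEST, MODE `(3,1)` of MODEL M_RWM,K** (lit-4): all admissible displacements have positive external
energy iff `δŴ₃(L₃, Λ)·ξ₁(1)² > 0`. [cite: Freidberg2014, §11.5.3 eq. (11.118)] -/
theorem externalModes_iff (Λ : ℝ) :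
    (∀ ξ : ℝ → ℝ, IsAdmissible ξ → 0 < PK.externalEnergy 3 kk 1 Λ ξ) ↔
      0 < Kq07M3.boundaryForm (1 * deriv Kq07M3.xi 1 / Kq07M3.xi 1) Λ * Kq07M3.xi 1 ^ 2 := by
  obtain ⟨hBθ, hBz, hp, hBθ0⟩ := Kq07.profile_regular (51 / 50)
  have hF : ∀ r ∈ Ioc (0 : ℝ) 1, PK.kDotB 3 kk r ≠ 0 := fun r hr => Kq07M3.kDotB_ne_zero hr.1 (by nlinarith [hr.1, hr.2])
  have hODE : ∀ r ∈ Ioo (0 : ℝ) 1,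
      HasDerivAt (fun s => PK.newcombF 3 kk s * deriv Kq07M3.xi s) (PK.newcombG 3 kk r * Kq07M3.xi r) r :=
    fun r hr => Kq07M3.xi_newcomb ⟨hr.1, by linarith [hr.2]⟩
  have h := Profile.newcombExternalModes_iff (P := PK) (m := 3) (k := kk) one_pos (by norm_num : (1 : ℝ) < 51 / 50)
    (by norm_num) hBθ hBz hp hBθ0 hF Kq07M3.xi_contDiffOn hODE Kq07M3.xi_ne_zero Λ
  rw [Kq07M3.boundaryForm_mul] at h
  constructor
  · intro hall
    exact h.1 fun ξ hξ hne => hall ξ ⟨hξ, hne⟩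
  · intro hpos ξ hξ
    exact h.2 hpos ξ hξ.1 hξ.2

/-- **NO WALL NEEDED: every admissible displacement has positive no-wall `(3,1)` energy** in MODEL M_RWM,K.
[cite: Freidberg2014, §11.5.6 eq. (11.151)] -/
theorem noWall_stable :
    ∀ ξ : ℝ → ℝ, IsAdmissible ξ → 0 < PK.externalEnergy 3 kk 1 (Vacuum.wallFactorInf 3 kk 1) ξ := by
  have h := dWinf_pos
  rw [Kq07M3.dWinf, externalEnergy_xi] at h
  exact (externalModes_iff _).2 h

/-- **With a perfectly conducting wall at any `b > a`**: every admissible displacement has positive `(3,1)` energy.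
[cite: Freidberg2014, §11.5.6 eq. (11.151)] -/
theorem idealWall_stable {b : ℝ} (hb : 1 < b) :
    ∀ ξ : ℝ → ℝ, IsAdmissible ξ → 0 < PK.externalEnergy 3 kk 1 (Vacuum.wallFactor 3 kk 1 b) ξ := by
  have h := dWb_pos hb
  rw [Kq07M3.dWb, externalEnergy_xi] at h
  exact (externalModes_iff _).2 h

/-- **NO RESISTIVE WALL MODE for the `(3,1)` mode of MODEL M_RWM,K**: for every wall `b > a`, every `γ` of the printed
thin-wall relation `γτ_w·δW_b = −δW_∞` with `τ_w > 0` is NEGATIVE (decay). [cite: Freidberg2014, §11.5.6 eq. (11.169)] -/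
theorem no_rwm {b γ τw : ℝ} (hb : 1 < b) (hτ : 0 < τw)
    (h : ResistiveWall.IsThinWallRate Kq07M3.dWinf (Kq07M3.dWb b) τw γ) : γ < 0 := by
  unfold ResistiveWall.IsThinWallRate at h
  have h1 := dWinf_pos
  have h2 := dWb_pos hb
  -- `γ τ_w δW_b = −δW_∞ < 0` with `τ_w, δW_b > 0`
  have hprod : γ * (τw * Kq07M3.dWb b) < 0 := by
    have : γ * τw * Kq07M3.dWb b = -Kq07M3.dWinf := h
    nlinarith
  have hpos : 0 < τw * Kq07M3.dWb b := mul_pos hτ h2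
  by_contra hge
  rw [not_lt] at hge
  have : 0 ≤ γ * (τw * Kq07M3.dWb b) := mul_nonneg hge hpos.le
  linarith

end Kq07M3

end RwmFRS1

end Summit.Ventures.FusionMHD.Models

end
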